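import Summits.BirchSwinnertonDyer.BirchSwinnertonDyer.Theorems.ByReductionTypeAtTwoSupersingularFlatZetaF3AssemblyPowTwo
import Summits.BirchSwinnertonDyer.BirchSwinnertonDyer.Theorems.ThetaPartnerAtTwoSignedKatoUpToAtTwoKatoBKTransport
import HarnessLib

/-!
# Crux `SupersingularRankZeroAtTwo` (K4, item stmt-BirchSwinnertonDyer-19097), line `odd_blind_package` v2.20 (39efd4f3),
# stub 2/5 `stub_flatPackage : FlatZetaPackageAtTwo` — FILE C2 of hand «hF3-CAP»: THE COPRIMALITY-WITH-GENUINENESS INPUT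
# `hcop` OF THE SOCKET, for the family of the normalisation of record

Seat `bsd-2adic-t42` GEN 52 (pen GEN 41 SUMMON 20260831T234826Z).  HONEST FRAMING (D-0054): THEOREMS ONLY — no definition, no
named fact, no instance, no notation, no `sorry`.  Displayed: the cusp multipliers `μ̃ δ ∉ 𝔭` (K3 brick B1
`KatoBK.cuspBrick_of_isNewformOf`), the genuineness of the lifts `s δ` (`Kato2004.exists_isEulerSystemClassTwo_of_zetaBody`), the
levelwise congruences `hE3` (FILE C1), the Sprung pair with `L♭ ≠ 0`.  Helper toward conjunct F3 of stub 2; closes NO stub; 19097 stays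
OPEN on its 5 registered stubs; nothing booked; BSD₂ is proved for no supersingular curve and BSD for no curve by any of this;
typed ≠ proved.

## What

The socket ★ `SSFlatFold.flatZeta_fblock_of_levelCongruences` (and its `_pow_two` twin) asks, at every height-one `𝔭 ∌ 2`, for a
member of the family whose multiplier avoids `𝔭` and whose class is a NON-ZERO GENUINE `2`-adic Euler class.  In the normalisation of
record the classes are `x δ := C(D δ) • s δ` (Kato's lift scaled by the clearing denominator of the cusp datum) and the multipliers
`A δ := C((N·q.num : ℤ)) · μ̃ δ`.
* §1 ★ `snd_coleman_ne_zero_of_levelCongruences` (`p`-generic) — NON-VANISHING WITHOUT ROHRLICH SIDE CONDITIONS: from the levelwise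
  congruences of a family whose multipliers are coprime at the height-one primes `∌ p`, a Sprung pair `(L♯, L♭)` with `L♭ ≠ 0`:
  every member with `A δ ≠ 0` has `Col♭(L x δ) ≠ 0`, so `x δ ≠ 0` — the slack Sprung pair of the family (t42 Z7
  ★ `SSFlatPackage.exists_pow_smul_eq_coleman_of_family`: `A δ • σ₀ = p^k • J(L x δ)`, `C d·σ₀.2 = p^k·L♭`).  This replaces
  `Kato2004.zetaBody_lift_ne_zero_of_rohrlich_two`, whose side conditions (`A ∣ c − 1`, `1 < c`, `[a/A]⁻ ≠ 0`) the brick's data do not carry.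
* §2 `mul_not_mem_of_not_mem` — `C((N·q.num:ℤ))·μ̃ ∉ 𝔭` from `μ̃ ∉ 𝔭`, `N·q.num ≠ 0`, `C 2 ∉ 𝔭` (`KatoBK.C_intCast_not_mem_of_ne_zero`).
* §3 ★★ `hcop_of_cuspFamily` — THE SOCKET'S `hcop` for the family of record: genuineness of `C(D δ) • s δ`
  (t42 Z7 `SSFlatPackage.isEulerSystemClassTwo_C_smul`), the multiplier from §2, non-vanishing from §1.

References: [Kato2004Asterisque] K. Kato, Astérisque 295 (2004), Thm. 12.5 (1)(4), Thm. 12.6 (p. 222), §13.9, §13.12 (pp. 230–233);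
[Sprung2017] F. Sprung, Thm. 1.12, Cor. 4.4; [Sprung2012] Def. 5.9, Def. 7.1; [Rubin2000] Def. 2.1.1; [Washington1997] §7.1, §13.1.
-/

set_option autoImplicit false
-- the Theorems namespace of this sub repeats the summit name by design (D-0017 nested layout)
set_option linter.dupNamespace false

noncomputable section

open scoped Classical NumberField

open Polynomial

namespace Summit.BirchSwinnertonDyer.BirchSwinnertonDyer.Theorems

namespace SSFlatCap

open NumberField IsDedekindDomain WeierstrassCurve Literature.NumberTheory.EllipticCurves
  Literature.NumberTheory.EllipticCurves.ZpExtension Literature.NumberTheory.EllipticCurves.Sprung2017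
  Literature.NumberTheory.EllipticCurves.Kobayashi2003 Literature.NumberTheory.EllipticCurves.Sprung2012
  Literature.NumberTheory.EllipticCurves.Rank1Residual Literature.NumberTheory.GaloisRepresentations CongruenceSubgroup
  Summit.BirchSwinnertonDyer.BirchSwinnertonDyer.Theorems.SSFlatPackage

/-! ## §1 Non-vanishing of the classes of a family with levelwise congruences -/

section SprungPair

universe u

variable {K : Type u} [Field K] {p : ℕ} [hp : Fact p.Prime] {κ : ZpExtension K p}
variable {E : Type u} [Field E] [Algebra K E] {ι' : AlgebraicClosure K →ₐ[K] AlgebraicClosure E}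
variable {W : WeierstrassCurve K}

/-- ★ **Every member with non-zero multiplier of a family with levelwise congruences has a non-zero ♭ Coleman value, hence is
non-zero.**  Data: the local data `(g, c)` entering through the Coleman values `hJ` (`p ∣ a_p`), `Λ`-linear `L`, `J`, a family
`x δ` with multipliers `A δ` coprime at the height-one primes `∌ p`, `d ≠ 0`, the congruences `hE3` against `θ̃_n`, a Sprung pair
`(L♯, L♭)` of `f` with `L♭ ≠ 0`.  By the slack Sprung pair of the family, `A δ · σ₀.2 = C(p)^k · Col♭(L x δ)` with
`C d · σ₀.2 = C(p)^k · L♭ ≠ 0`. [cite: Kato2004Asterisque, Thm. 12.5 (4), §13.9 (p. 230)] [cite: Sprung2017, Thm. 1.12, Cor. 4.4] -/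
theorem snd_coleman_ne_zero_of_levelCongruences {g : Field.absoluteGaloisGroup E}
    (hg : κ.IsTopGenerator (resGalOfEmb ι' g)) {ap : ℤ} (hap : (p : ℤ) ∣ ap) {c : ℕ → localPoints W E}
    {H : Type*} [AddCommGroup H] [Module (IwasawaAlgebra p) H]
    (L : letI := moduleOfGenerator κ ι' W hg; H →ₗ[IwasawaAlgebra p] (localTowerPointsOfEmb κ ι' W →+ ℤ_[p]))
    (J : letI := moduleOfGenerator κ ι' W hg
      (localTowerPointsOfEmb κ ι' W →+ ℤ_[p]) →ₗ[IwasawaAlgebra p] IwasawaAlgebra p × IwasawaAlgebra p)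
    (hJ : ∀ w, IsColemanPair κ ι' W ap g c w (J w).1 (J w).2)
    {ι : Type*} (x : ι → H) (A : ι → IwasawaAlgebra p) {d : ℤ_[p]} (hd : d ≠ 0)
    (hcop : ∀ 𝔭 : PrimeSpectrum (IwasawaAlgebra p), 𝔭.asIdeal.height = 1 →
      PowerSeries.C (p : ℤ_[p]) ∉ 𝔭.asIdeal → ∃ i, A i ∉ 𝔭.asIdeal)
    {N : ℕ} (f : CuspForm (Gamma0 N) 2) {Lsharp Lflat : IwasawaAlgebra p} (hL : IsSprungPair f p ap Lsharp Lflat)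
    (hLf : Lflat ≠ 0)
    (hE3 : ∀ (i : ι) (n : ℕ), ∃ (m : ℕ) (q : IwasawaAlgebra p), PowerSeries.C ((p : ℚ_[p]) ^ m) *
        (iwasawaToPowerSeries p (A i) * (((mazurTateElement f p n).map (algebraMap ℚ ℚ_[p]) : ℚ_[p][X]) : PowerSeries ℚ_[p]) -
          iwasawaToPowerSeries p (PowerSeries.C d * pairingSum W (localTowerPointsOfEmb κ ι' W) g n (c n) (L (x i)))) =
      iwasawaToPowerSeries p ((((cyclotomicOmega p n).map (Int.castRingHom ℤ_[p]) : ℤ_[p][X]) : PowerSeries ℤ_[p]) * q))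
    {i : ι} (hAi : A i ≠ 0) :
    (J (L (x i))).2 ≠ 0 ∧ x i ≠ 0 := by
  letI := moduleOfGenerator κ ι' W hg
  obtain ⟨σ₀, k, hσ₀, -, hflat⟩ := exists_pow_smul_eq_coleman_of_family hg hap L J hJ x A hd hcop f hL hE3
  have hpk : (PowerSeries.C (p : ℤ_[p]) : IwasawaAlgebra p) ^ k ≠ 0 :=
    pow_ne_zero k (Literature.NumberTheory.EllipticCurves.IwasawaAlgebra.prime_C p).ne_zero
  have hσ2 : σ₀.2 ≠ 0 := by
    intro h0
    refine mul_ne_zero hpk hLf ?_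
    rw [← hflat, h0, mul_zero]
  have hnz : (J (L (x i))).2 ≠ 0 := by
    intro h0
    have h := congrArg Prod.snd (hσ₀ i)
    rw [Prod.smul_snd, Prod.smul_snd, smul_eq_mul, smul_eq_mul, h0, mul_zero] at h
    exact mul_ne_zero hAi hσ2 h
  refine ⟨hnz, fun h0 ↦ hnz ?_⟩
  rw [h0, map_zero, map_zero, Prod.snd_zero]

end SprungPair

/-! ## §2 The multiplier `C((N·q.num : ℤ)) · μ̃` avoids `𝔭` -/

/-- `C z · μ̃ ∉ 𝔭` for a height-one `𝔭 ∌ 2`, `z ≠ 0` an integer, `μ̃ ∉ 𝔭` (`𝔭` prime; `KatoBK.C_intCast_not_mem_of_ne_zero`).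
[cite: Washington1997, §7.1] -/
theorem C_mul_not_mem_of_not_mem {𝔭 : PrimeSpectrum (IwasawaAlgebra 2)} (h2 : PowerSeries.C (2 : ℤ_[2]) ∉ 𝔭.asIdeal)
    {z : ℤ} (hz : z ≠ 0) {μt : IwasawaAlgebra 2} (hμ : μt ∉ 𝔭.asIdeal) :
    PowerSeries.C ((z : ℤ_[2])) * μt ∉ 𝔭.asIdeal := fun h ↦
  (𝔭.isPrime.mem_or_mem h).elim (SignedKatoOffTwo.KatoBK.C_intCast_not_mem_of_ne_zero 𝔭.isPrime h2 hz) hμ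

/-! ## §3 The socket's `hcop` for the family of record -/

section Habitat

variable (W : WeierstrassCurve ℚ) [W.IsElliptic] [ContinuousSMul ℤ_[2] (W.tateModule 2)]
  [Module.Free ℤ_[2] (W.tateModule 2)] [Module.Finite ℤ_[2] (W.tateModule 2)]
  {κ : ZpExtension ℚ 2} (hκ : κ.IsCyclotomic) {γ : Field.absoluteGaloisGroup ℚ}
  {E : Type} [Field E] [Algebra ℚ E] (ιE : AlgebraicClosure ℚ →ₐ[ℚ] AlgebraicClosure E)
  {g : Field.absoluteGaloisGroup E} {c : ℕ → localPoints W E}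

/-- ★★ **THE COPRIMALITY-WITH-GENUINENESS INPUT `hcop` OF THE F3 SOCKET, for the family of record.**  For the pin `I`, the
local data `(g, c)` through `hJ` (`2 ∣ a_p`), `Λ`-linear `L`, `J`, a Sprung pair `(L♯, L♭)` with `L♭ ≠ 0`, and a family of GENUINE
classes `s δ` (`IsEulerSystemClassTwo`) with clearing denominators `D δ`, cusp multipliers `μ̃ δ` avoiding every height-one `𝔭 ∌ 2`
(some `δ` per `𝔭`), `N·q.num ≠ 0`, and the levelwise congruences for `x δ := C(D δ) • s δ`, `A δ := C((N·q.num:ℤ))·μ̃ δ`, `d := q.den`: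
at every height-one `𝔭 ∌ 2` some `A δ ∉ 𝔭` with `x δ` a NON-ZERO GENUINE `2`-adic Euler class — literally the `hcop` of
★ `SSFlatFold.flatZeta_fblock_of_levelCongruences` for this family. [cite: Kato2004Asterisque, Thm. 12.5 (1)(4), Thm. 12.6 (p. 222), §13.12 (pp. 231–233)]
[cite: Sprung2017, Thm. 1.12, Cor. 4.4] [cite: Rubin2000, Def. 2.1.1 and Remark 2.1.4] -/
theorem hcop_of_cuspFamily (hg : κ.IsTopGenerator (resGalOfEmb ιE g)) {ap : ℤ} (hap : (2 : ℤ) ∣ ap)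
    (I : Kato2004.IwasawaH1Data W 2 κ γ)
    (L : letI := moduleOfGenerator κ ιE W hg; I.H →ₗ[IwasawaAlgebra 2] (localTowerPointsOfEmb κ ιE W →+ ℤ_[2]))
    (J : letI := moduleOfGenerator κ ιE W hg
      (localTowerPointsOfEmb κ ιE W →+ ℤ_[2]) →ₗ[IwasawaAlgebra 2] IwasawaAlgebra 2 × IwasawaAlgebra 2)
    (hJ : ∀ w, IsColemanPair κ ιE W ap g c w (J w).1 (J w).2)
    {M' : ℕ} (f : CuspForm (Gamma0 M') 2) {Ls Lf : IwasawaAlgebra 2} (hL : IsSprungPair f 2 ap Ls Lf) (hLf : Lf ≠ 0)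
    {Δ : Type*} (s : Δ → I.H)
    (hgen : ∀ δ, Literature.NumberTheory.EllipticCurves.Kato2004.IsEulerSystemClassTwo W hκ I (s δ))
    (D : Δ → ℤ) (μt : Δ → IwasawaAlgebra 2) {N : ℕ} {q : ℚ} (hNq : ((N : ℤ) * q.num : ℤ) ≠ 0)
    (hμ : ∀ 𝔭 : PrimeSpectrum (IwasawaAlgebra 2), 𝔭.asIdeal.height = 1 →
      PowerSeries.C (2 : ℤ_[2]) ∉ 𝔭.asIdeal → ∃ δ, μt δ ∉ 𝔭.asIdeal)
    (hE3 : ∀ (δ : Δ) (n : ℕ), ∃ (m : ℕ) (q' : IwasawaAlgebra 2), PowerSeries.C ((2 : ℚ_[2]) ^ m) *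
        (iwasawaToPowerSeries 2 (PowerSeries.C ((((N : ℤ) * q.num : ℤ) : ℤ_[2])) * μt δ) *
            (((mazurTateElement f 2 n).map (algebraMap ℚ ℚ_[2]) : ℚ_[2][X]) : PowerSeries ℚ_[2]) -
          iwasawaToPowerSeries 2 (PowerSeries.C ((q.den : ℤ) : ℤ_[2]) *
            pairingSum W (localTowerPointsOfEmb κ ιE W) g n (c n)
              (L ((PowerSeries.C ((D δ : ℤ) : ℤ_[2]) : IwasawaAlgebra 2) • s δ)))) =
      iwasawaToPowerSeries 2 ((((cyclotomicOmega 2 n).map (Int.castRingHom ℤ_[2]) : ℤ_[2][X]) : PowerSeries ℤ_[2]) * q')) :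
    ∀ 𝔭 : PrimeSpectrum (IwasawaAlgebra 2), 𝔭.asIdeal.height = 1 →
      PowerSeries.C (2 : ℤ_[2]) ∉ 𝔭.asIdeal → ∃ δ, PowerSeries.C ((((N : ℤ) * q.num : ℤ) : ℤ_[2])) * μt δ ∉ 𝔭.asIdeal ∧
        Literature.NumberTheory.EllipticCurves.Kato2004.IsEulerSystemClassTwo W hκ I
          ((PowerSeries.C ((D δ : ℤ) : ℤ_[2]) : IwasawaAlgebra 2) • s δ) ∧
        (PowerSeries.C ((D δ : ℤ) : ℤ_[2]) : IwasawaAlgebra 2) • s δ ≠ 0 := by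
  letI := moduleOfGenerator κ ιE W hg
  intro 𝔭 h𝔭 h2
  obtain ⟨δ, hδ⟩ := hμ 𝔭 h𝔭 h2
  have hA : PowerSeries.C ((((N : ℤ) * q.num : ℤ) : ℤ_[2])) * μt δ ∉ 𝔭.asIdeal := C_mul_not_mem_of_not_mem h2 hNq hδ
  have hA0 : PowerSeries.C ((((N : ℤ) * q.num : ℤ) : ℤ_[2])) * μt δ ≠ 0 := fun h ↦ hA (h ▸ 𝔭.asIdeal.zero_mem)
  -- the coprimality of the multipliers at the height-one primes `∌ 2`, in the `(p : ℤ_[p])` dialect of §1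
  have hcopA : ∀ 𝔭 : PrimeSpectrum (IwasawaAlgebra 2), 𝔭.asIdeal.height = 1 →
      PowerSeries.C ((2 : ℕ) : ℤ_[2]) ∉ 𝔭.asIdeal → ∃ δ, PowerSeries.C ((((N : ℤ) * q.num : ℤ) : ℤ_[2])) * μt δ ∉ 𝔭.asIdeal := by
    intro 𝔮 h𝔮 h2'
    have h2'' : PowerSeries.C (2 : ℤ_[2]) ∉ 𝔮.asIdeal := by simpa using h2'
    obtain ⟨δ', hδ'⟩ := hμ 𝔮 h𝔮 h2''
    exact ⟨δ', C_mul_not_mem_of_not_mem h2'' hNq hδ'⟩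
  have hd : ((q.den : ℤ) : ℤ_[2]) ≠ 0 := by exact_mod_cast q.den_ne_zero
  have hE3' : ∀ (δ : Δ) (n : ℕ), ∃ (m : ℕ) (q' : IwasawaAlgebra 2), PowerSeries.C (((2 : ℕ) : ℚ_[2]) ^ m) *
        (iwasawaToPowerSeries 2 (PowerSeries.C ((((N : ℤ) * q.num : ℤ) : ℤ_[2])) * μt δ) *
            (((mazurTateElement f 2 n).map (algebraMap ℚ ℚ_[2]) : ℚ_[2][X]) : PowerSeries ℚ_[2]) -
          iwasawaToPowerSeries 2 (PowerSeries.C ((q.den : ℤ) : ℤ_[2]) *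
            pairingSum W (localTowerPointsOfEmb κ ιE W) g n (c n)
              (L ((PowerSeries.C ((D δ : ℤ) : ℤ_[2]) : IwasawaAlgebra 2) • s δ)))) =
      iwasawaToPowerSeries 2 ((((cyclotomicOmega 2 n).map (Int.castRingHom ℤ_[2]) : ℤ_[2][X]) : PowerSeries ℤ_[2]) * q') :=
    fun δ n ↦ by simpa only [Nat.cast_ofNat] using hE3 δ n
  have hne := snd_coleman_ne_zero_of_levelCongruences hg (by exact_mod_cast hap) L J hJ
    (fun δ ↦ (PowerSeries.C ((D δ : ℤ) : ℤ_[2]) : IwasawaAlgebra 2) • s δ)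
    (fun δ ↦ PowerSeries.C ((((N : ℤ) * q.num : ℤ) : ℤ_[2])) * μt δ) hd hcopA f hL hLf hE3' hA0
  exact ⟨δ, hA, isEulerSystemClassTwo_C_smul W hκ I (hgen δ) _, hne.2⟩

end Habitat

end SSFlatCap

end Summit.BirchSwinnertonDyer.BirchSwinnertonDyer.Theorems

end
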